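import Summits.HodgeConjecture.HodgeConjecture.Theorems.UeP4UnivFamilyLDeltaClass
import HarnessLib

/-!
# U-e P4, (N3-core) assembler leaf (A1) on a PIECE of the base: the global class read on the fibres of a base-changed family

Cell hodgecm-mathlib (D-0151), rung 0 of the Mumford line under `HDel` (item `stmt-HodgeConjecture-24835`), (U)-HEAD, node U-e,
socket P4 in PIECE currency (B-plan1 (g13) GO-PIECE 18:25:29Z; P4 lead B-p03 (g14)); hand B-p16 (g12).  THEOREMS ONLY; books 0.
HC_CM is proved only modulo the 7 printed citations until rung 0 closes; nothing here changes that count.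

For the base change `f₁ := familyPullback.snd f g` of `f := W1.univFamilyℂ 𝓜` along `g : S′ → M ⊗ ℂ`, a complex point `y` of
`S′`, and a fibre triple `P′` with base-change witnesses along the `ℚ`-side reading of `g(y)`, the piece-pinned identification is
`e₁ := (fibreAVIso P′ ≪≫ fiberUnivIso⁻¹ ≪≫ (fiberOverFamilyPullbackIso f g y)⁻¹)(ℂ)`.
* `coreEulerClass_fibre_reading_piece` — ★ (A1-top) `UnivFamilyLDeltaClass.coreEulerClass_fibre_reading` re-threaded: the Euler
  class `e(c)` of a cocycle `c` on `X ⊗ ℂ` representing `(pr^* L)^q`, restricted along `(f₁)⁻¹(y) → (X ⊗ ℂ) ×_{M ⊗ ℂ} S′ → X ⊗ ℂ`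
  and read through `e₁`, is `e(c′)` for any cocycle `c′` on `(P′.A)_𝟙` representing `((fst ≫ G)^* L)^q` — one `fiberOverFamilyPullbackIso`
  cancellation on top of the ★ statement.

## References
* [MumfordFogartyKirwan1994] D. Mumford, J. Fogarty, F. Kirwan, *Geometric Invariant Theory*, 3rd ed. (1994), Ch. 7 §2
  Definition 7.3 (p. 129); Appendix to Ch. 7 §A (p. 235).
* [Hartshorne1977] R. Hartshorne, *Algebraic Geometry* (1977), Ch. II Ex. 6.8 (a), Ch. III Ex. 4.5; Ch. II §3 p. 89.
-/

set_option autoImplicit false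

-- mandated namespace `Summit.HodgeConjecture.HodgeConjecture.Theorems` trips `linter.dupNamespace` (single-problem summit; the lakefile turns
-- the linter off tree-wide as a weak option), restated here so stand-alone elaboration is warning-free (as in ★ `SiegelUniversalFamilyHodgeFrames`).
set_option linter.dupNamespace false

noncomputable section

open CategoryTheory CategoryTheory.Limits AlgebraicGeometry
open _root_.Topology _root_.Filter

namespace Summit.HodgeConjecture.HodgeConjecture.Theorems

namespace UnivFamilyLDeltaClass

open Literature.AlgebraicGeometry
open Literature.AlgebraicGeometry.Motives
open Literature.AlgebraicGeometry.Modules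
open Literature.AlgebraicGeometry.HodgeTheory
open Literature.AlgebraicGeometry.AbelianSchemes (PolarizedAbelianSchemeWithLevel AbelianSchemeOver)
open Literature.AlgebraicGeometry.ModuliOfAbelianVarieties
open Literature.AlgebraicGeometry.ModuliOfAbelianVarieties.W1
open Literature.AlgebraicTopology.SingularHomology
open Literature.AlgebraicTopology.CharacteristicClasses

variable {g N : ℕ} {δ : Fin g → ℕ} (𝓜 : SiegelFineModuliScheme g N δ) {S' : SchemeOver ℂ}
  (gS : S' ⟶ (Motives.baseChange ℚ ℂ).obj 𝓜.M) (y : ComplexPoints S')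
  (P' : PolarizedAbelianSchemeWithLevel g N δ (specOver ℚ ℂ).left)
  (G : P'.A.X.left ⟶ 𝓜.univ.A.X.left) (Ĝ : P'.D.hat.X.left ⟶ 𝓜.univ.D.hat.X.left)
  (h : P'.IsBaseChangeVia 𝓜.univ
    ((AlgPoints.baseChangeEquiv (algebraMap ℚ ℂ) 𝓜.M).symm (AlgPoints.map gS y)).left G Ĝ)

/-- **(A1-piece) The global class and its fibre readings, on a piece.**  With `t := g(y)`, `f₁ := familyPullback.snd f g` and the
piece-pinned `e₁ = (fibreAVIso ≪≫ fiberUnivIso⁻¹ ≪≫ fiberOverFamilyPullbackIso⁻¹)(ℂ)`: the Euler class `e(c)` on `(X ⊗ ℂ)(ℂ)` restricted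
along `(f₁)⁻¹(y) ↪ (X ⊗ ℂ) ×_{M ⊗ ℂ} S′ → X ⊗ ℂ` and read through `e₁` equals `e(c′)` — ★ `coreEulerClass_fibre_reading` at `t`
plus the cancellation `fiberOverFamilyPullbackIso⁻¹ ≫ fiberOverFamilyPullbackIso = 𝟙` (★ `fiberOverFamilyPullbackIso_hom_fiberι`).
[cite: Hartshorne1977, Ch. II Ex. 6.8 (a) and Ch. III Ex. 4.5] [cite: MumfordFogartyKirwan1994, Ch. 7 §2 Definition 7.3 (p. 129)] -/
theorem coreEulerClass_fibre_reading_piece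
    [T2Space (ComplexPoints ((Motives.baseChange ℚ ℂ).obj (univTotal 𝓜)))]
    [ParacompactSpace (ComplexPoints ((Motives.baseChange ℚ ℂ).obj (univTotal 𝓜)))]
    [T2Space (ComplexPoints (fibreAV P').X)] [ParacompactSpace (ComplexPoints (fibreAV P').X)]
    (L : CechPic 𝓜.univ.A.X.left) (q : ℕ)
    (c : UnitCocycle ((Motives.baseChange ℚ ℂ).obj (univTotal 𝓜)).left) (c' : UnitCocycle (fibreAV P').X.left)
    (hc : CechPic.mk c = CechPic.pullback (baseChangeHomFst (algebraMap ℚ ℂ) (univTotal 𝓜)) L ^ q)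
    (hc' : CechPic.mk c' = CechPic.pullback (pullback.fst P'.A.X.hom (𝟙 (Spec (CommRingCat.of ℂ))) ≫ G) L ^ q) :
    singularCohomology.map ℂ ℂ
        ((AlgPoints.homeomorphOfIso (L := ℂ)
            (fibreAVIso P' ≪≫ (fiberUnivIsoOfIsBaseChangeVia 𝓜 (AlgPoints.map gS y) P' G Ĝ h).symm ≪≫
              (fiberOverFamilyPullbackIso (univFamilyℂ 𝓜) gS y).symm) :
            ComplexPoints (fibreAV P').X ≃ₜ ComplexPoints (fiberOver (familyPullback.snd (univFamilyℂ 𝓜) gS) y)) :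
          C(ComplexPoints (fibreAV P').X, ComplexPoints (fiberOver (familyPullback.snd (univFamilyℂ 𝓜) gS) y))) 2
        (complexBetti.map (fiberι (familyPullback.snd (univFamilyℂ 𝓜) gS) y ≫ familyPullback.fst (univFamilyℂ 𝓜) gS) 2
          (eulerClass ℂ c.complexCore.Fiber (Module.finrank_self ℂ) ℂ 1)) =
      eulerClass ℂ c'.complexCore.Fiber (Module.finrank_self ℂ) ℂ 1 := by
  rw [← coreEulerClass_fibre_reading 𝓜 (AlgPoints.map gS y) P' G Ĝ h L q c c' hc hc']
  -- both sides are pull-backs of `e(c)` restricted to `X_t`, along `e₁ ≫ (f₁)⁻¹(y) ⊂ total ⊂ X ⊗ ℂ` resp. along `e`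
  have hcoe₁ : ((AlgPoints.homeomorphOfIso (L := ℂ)
        (fibreAVIso P' ≪≫ (fiberUnivIsoOfIsBaseChangeVia 𝓜 (AlgPoints.map gS y) P' G Ĝ h).symm ≪≫
          (fiberOverFamilyPullbackIso (univFamilyℂ 𝓜) gS y).symm) :
        ComplexPoints (fibreAV P').X ≃ₜ ComplexPoints (fiberOver (familyPullback.snd (univFamilyℂ 𝓜) gS) y)) :
        C(ComplexPoints (fibreAV P').X, ComplexPoints (fiberOver (familyPullback.snd (univFamilyℂ 𝓜) gS) y))) =
      AlgPoints.mapContinuous (L := ℂ)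
        ((fibreAVIso P' ≪≫ (fiberUnivIsoOfIsBaseChangeVia 𝓜 (AlgPoints.map gS y) P' G Ĝ h).symm).hom ≫
          (fiberOverFamilyPullbackIso (univFamilyℂ 𝓜) gS y).inv) := rfl
  have hcoe : ((AlgPoints.homeomorphOfIso (L := ℂ)
        (fibreAVIso P' ≪≫ (fiberUnivIsoOfIsBaseChangeVia 𝓜 (AlgPoints.map gS y) P' G Ĝ h).symm) :
        ComplexPoints (fibreAV P').X ≃ₜ ComplexPoints (fiberOver (univFamilyℂ 𝓜) (AlgPoints.map gS y))) :
        C(ComplexPoints (fibreAV P').X, ComplexPoints (fiberOver (univFamilyℂ 𝓜) (AlgPoints.map gS y)))) =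
      AlgPoints.mapContinuous (L := ℂ)
        (fibreAVIso P' ≪≫ (fiberUnivIsoOfIsBaseChangeVia 𝓜 (AlgPoints.map gS y) P' G Ĝ h).symm).hom := rfl
  rw [hcoe₁, hcoe]
  change (complexBetti.map (fiberι (familyPullback.snd (univFamilyℂ 𝓜) gS) y ≫ familyPullback.fst (univFamilyℂ 𝓜) gS) 2 ≫
      complexBetti.map (((fibreAVIso P' ≪≫ (fiberUnivIsoOfIsBaseChangeVia 𝓜 (AlgPoints.map gS y) P' G Ĝ h).symm).hom ≫
        (fiberOverFamilyPullbackIso (univFamilyℂ 𝓜) gS y).inv)) 2) _ =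
    (complexBetti.map (fiberι (univFamilyℂ 𝓜) (AlgPoints.map gS y)) 2 ≫
      complexBetti.map ((fibreAVIso P' ≪≫ (fiberUnivIsoOfIsBaseChangeVia 𝓜 (AlgPoints.map gS y) P' G Ĝ h).symm).hom) 2) _
  rw [← complexBetti.map_comp, ← complexBetti.map_comp]
  have hmor : (((fibreAVIso P' ≪≫ (fiberUnivIsoOfIsBaseChangeVia 𝓜 (AlgPoints.map gS y) P' G Ĝ h).symm).hom ≫
        (fiberOverFamilyPullbackIso (univFamilyℂ 𝓜) gS y).inv) ≫
      (fiberι (familyPullback.snd (univFamilyℂ 𝓜) gS) y ≫ familyPullback.fst (univFamilyℂ 𝓜) gS)) =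
      ((fibreAVIso P' ≪≫ (fiberUnivIsoOfIsBaseChangeVia 𝓜 (AlgPoints.map gS y) P' G Ĝ h).symm).hom ≫
        fiberι (univFamilyℂ 𝓜) (AlgPoints.map gS y)) := by
    rw [← fiberOverFamilyPullbackIso_hom_fiberι]
    simp only [Category.assoc, Iso.inv_hom_id_assoc]
  erw [hmor]

/-- **(A1-sq-piece) The scheme square of the piece-pinned identification**: on underlying schemes,
`e′.hom ≫ ((f₁)⁻¹(t) ↪ (X ⊗ ℂ) ×_{M ⊗ ℂ} S′) ≫ ((X ⊗ ℂ) ×_{M ⊗ ℂ} S′ → X ⊗ ℂ) ≫ (X ⊗ ℂ → X) = ((P′.A)_𝟙 → P′.A) ≫ G`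
(★ (A1-sq) + ★ `fiberOverFamilyPullbackIso_hom_fiberι`). [cite: MumfordFogartyKirwan1994, Ch. 7 §2 Definition 7.3 (p. 129)]
[cite: Hartshorne1977, Ch. II §3 p. 89] -/
theorem fibreAVIso_fiberUnivIso_inv_familyPullbackIso_inv_fiberι_comp_fst :
    ((fibreAVIso P' ≪≫ (fiberUnivIsoOfIsBaseChangeVia 𝓜 (AlgPoints.map gS y) P' G Ĝ h).symm ≪≫
        (fiberOverFamilyPullbackIso (univFamilyℂ 𝓜) gS y).symm).hom).left ≫
      (fiberι (familyPullback.snd (univFamilyℂ 𝓜) gS) y).left ≫ (familyPullback.fst (univFamilyℂ 𝓜) gS).left ≫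
        baseChangeHomFst (algebraMap ℚ ℂ) (univTotal 𝓜) =
      pullback.fst P'.A.X.hom (𝟙 (Spec (CommRingCat.of ℂ))) ≫ G := by
  rw [← fibreAVIso_fiberUnivIso_inv_fiberι_comp_fst 𝓜 (AlgPoints.map gS y) P' G Ĝ h]
  have hmor : (fibreAVIso P' ≪≫ (fiberUnivIsoOfIsBaseChangeVia 𝓜 (AlgPoints.map gS y) P' G Ĝ h).symm ≪≫
        (fiberOverFamilyPullbackIso (univFamilyℂ 𝓜) gS y).symm).hom ≫
      fiberι (familyPullback.snd (univFamilyℂ 𝓜) gS) y ≫ familyPullback.fst (univFamilyℂ 𝓜) gS =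
      (fibreAVIso P' ≪≫ (fiberUnivIsoOfIsBaseChangeVia 𝓜 (AlgPoints.map gS y) P' G Ĝ h).symm).hom ≫
        fiberι (univFamilyℂ 𝓜) (AlgPoints.map gS y) := by
    rw [← fiberOverFamilyPullbackIso_hom_fiberι]
    simp only [Iso.trans_hom, Iso.symm_hom, Category.assoc, Iso.inv_hom_id_assoc]
  have hleft := congrArg CommaMorphism.left hmor
  simp only [Over.comp_left] at hleft
  calc ((fibreAVIso P' ≪≫ (fiberUnivIsoOfIsBaseChangeVia 𝓜 (AlgPoints.map gS y) P' G Ĝ h).symm ≪≫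
          (fiberOverFamilyPullbackIso (univFamilyℂ 𝓜) gS y).symm).hom).left ≫
        (fiberι (familyPullback.snd (univFamilyℂ 𝓜) gS) y).left ≫ (familyPullback.fst (univFamilyℂ 𝓜) gS).left ≫
          baseChangeHomFst (algebraMap ℚ ℂ) (univTotal 𝓜)
        = (((fibreAVIso P' ≪≫ (fiberUnivIsoOfIsBaseChangeVia 𝓜 (AlgPoints.map gS y) P' G Ĝ h).symm ≪≫
            (fiberOverFamilyPullbackIso (univFamilyℂ 𝓜) gS y).symm).hom).left ≫
          (fiberι (familyPullback.snd (univFamilyℂ 𝓜) gS) y).left ≫ (familyPullback.fst (univFamilyℂ 𝓜) gS).left) ≫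
          baseChangeHomFst (algebraMap ℚ ℂ) (univTotal 𝓜) := by simp only [Category.assoc]
    _ = (((fibreAVIso P' ≪≫ (fiberUnivIsoOfIsBaseChangeVia 𝓜 (AlgPoints.map gS y) P' G Ĝ h).symm).hom).left ≫
          (fiberι (univFamilyℂ 𝓜) (AlgPoints.map gS y)).left) ≫ baseChangeHomFst (algebraMap ℚ ℂ) (univTotal 𝓜) := by
          erw [hleft]
    _ = _ := by simp only [Category.assoc]

/-- **(A1-piece′) The global class OF THE PIECE and its fibre readings** (the (R-piece) assembler's input shape, B-p03 (g14)
18:33:06Z): for a cocycle `c` on the piece total space `(X ⊗ ℂ) ×_{M ⊗ ℂ} S′` representing `((fst ≫ pr)^* L)^q` and a cocycle `c′` on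
`(P′.A)_𝟙` representing `(((P′.A)_𝟙 → P′.A ≫ G)^* L)^q`, the Euler class `e(c)` restricted to the fibre `(f₁)⁻¹(t)(ℂ)` and read through
the piece-pinned `e′` is `e(c′)` — ★ `UnitCocycle.coreEulerClass_pullback` along `e′.hom ≫ ((f₁)⁻¹(t) ↪ total)`, ★
`UnitCocycle.coreEulerClass_eq_of_mk_eq`, `CechPic.pullback` multiplicative/functorial, and (A1-sq-piece).
[cite: Hartshorne1977, Ch. II Ex. 6.8 (a) and Ch. III Ex. 4.5] [cite: MumfordFogartyKirwan1994, Ch. 7 §2 Definition 7.3 (p. 129)] -/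
theorem coreEulerClass_fibre_reading_piece'
    [T2Space (ComplexPoints (familyPullback (univFamilyℂ 𝓜) gS))]
    [ParacompactSpace (ComplexPoints (familyPullback (univFamilyℂ 𝓜) gS))]
    [T2Space (ComplexPoints (fibreAV P').X)] [ParacompactSpace (ComplexPoints (fibreAV P').X)]
    (L : CechPic 𝓜.univ.A.X.left) (q : ℕ)
    (c : UnitCocycle (familyPullback (univFamilyℂ 𝓜) gS).left) (c' : UnitCocycle (fibreAV P').X.left)
    (hc : CechPic.mk c =
      CechPic.pullback ((familyPullback.fst (univFamilyℂ 𝓜) gS).left ≫ baseChangeHomFst (algebraMap ℚ ℂ) (univTotal 𝓜)) L ^ q)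
    (hc' : CechPic.mk c' = CechPic.pullback (pullback.fst P'.A.X.hom (𝟙 (Spec (CommRingCat.of ℂ))) ≫ G) L ^ q) :
    singularCohomology.map ℂ ℂ
        ((AlgPoints.homeomorphOfIso (L := ℂ)
            (fibreAVIso P' ≪≫ (fiberUnivIsoOfIsBaseChangeVia 𝓜 (AlgPoints.map gS y) P' G Ĝ h).symm ≪≫
              (fiberOverFamilyPullbackIso (univFamilyℂ 𝓜) gS y).symm) :
            ComplexPoints (fibreAV P').X ≃ₜ ComplexPoints (fiberOver (familyPullback.snd (univFamilyℂ 𝓜) gS) y)) :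
          C(ComplexPoints (fibreAV P').X, ComplexPoints (fiberOver (familyPullback.snd (univFamilyℂ 𝓜) gS) y))) 2
        (complexBetti.map (fiberι (familyPullback.snd (univFamilyℂ 𝓜) gS) y) 2
          (eulerClass ℂ c.complexCore.Fiber (Module.finrank_self ℂ) ℂ 1)) =
      eulerClass ℂ c'.complexCore.Fiber (Module.finrank_self ℂ) ℂ 1 := by
  have hcoe : ((AlgPoints.homeomorphOfIso (L := ℂ)
        (fibreAVIso P' ≪≫ (fiberUnivIsoOfIsBaseChangeVia 𝓜 (AlgPoints.map gS y) P' G Ĝ h).symm ≪≫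
          (fiberOverFamilyPullbackIso (univFamilyℂ 𝓜) gS y).symm) :
        ComplexPoints (fibreAV P').X ≃ₜ ComplexPoints (fiberOver (familyPullback.snd (univFamilyℂ 𝓜) gS) y)) :
        C(ComplexPoints (fibreAV P').X, ComplexPoints (fiberOver (familyPullback.snd (univFamilyℂ 𝓜) gS) y))) =
      AlgPoints.mapContinuous (L := ℂ)
        (fibreAVIso P' ≪≫ (fiberUnivIsoOfIsBaseChangeVia 𝓜 (AlgPoints.map gS y) P' G Ĝ h).symm ≪≫
          (fiberOverFamilyPullbackIso (univFamilyℂ 𝓜) gS y).symm).hom := rfl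
  rw [hcoe]
  have hcomp : singularCohomology.map ℂ ℂ
        (AlgPoints.mapContinuous (L := ℂ)
          (fibreAVIso P' ≪≫ (fiberUnivIsoOfIsBaseChangeVia 𝓜 (AlgPoints.map gS y) P' G Ĝ h).symm ≪≫
            (fiberOverFamilyPullbackIso (univFamilyℂ 𝓜) gS y).symm).hom) 2
        (complexBetti.map (fiberι (familyPullback.snd (univFamilyℂ 𝓜) gS) y) 2
          (eulerClass ℂ c.complexCore.Fiber (Module.finrank_self ℂ) ℂ 1)) =
      singularCohomology.map ℂ ℂ
        (AlgPoints.mapContinuous (L := ℂ)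
          ((fibreAVIso P' ≪≫ (fiberUnivIsoOfIsBaseChangeVia 𝓜 (AlgPoints.map gS y) P' G Ĝ h).symm ≪≫
            (fiberOverFamilyPullbackIso (univFamilyℂ 𝓜) gS y).symm).hom ≫
            fiberι (familyPullback.snd (univFamilyℂ 𝓜) gS) y)) 2
        (eulerClass ℂ c.complexCore.Fiber (Module.finrank_self ℂ) ℂ 1) := by
    change (complexBetti.map (fiberι (familyPullback.snd (univFamilyℂ 𝓜) gS) y) 2 ≫
        complexBetti.map ((fibreAVIso P' ≪≫ (fiberUnivIsoOfIsBaseChangeVia 𝓜 (AlgPoints.map gS y) P' G Ĝ h).symm ≪≫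
          (fiberOverFamilyPullbackIso (univFamilyℂ 𝓜) gS y).symm).hom) 2) _ =
      complexBetti.map (((fibreAVIso P' ≪≫ (fiberUnivIsoOfIsBaseChangeVia 𝓜 (AlgPoints.map gS y) P' G Ĝ h).symm ≪≫
          (fiberOverFamilyPullbackIso (univFamilyℂ 𝓜) gS y).symm).hom) ≫
        fiberι (familyPullback.snd (univFamilyℂ 𝓜) gS) y) 2 _
    rw [← complexBetti.map_comp]
  rw [hcomp, ← UnitCocycle.coreEulerClass_pullback]
  refine UnitCocycle.coreEulerClass_eq_of_mk_eq ℂ ?_ 1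
  rw [hc', ← CechPic.pullback_mk, hc]
  erw [MonoidHom.map_pow, ← CechPic.pullback_comp]
  congr 2
  rw [Over.comp_left, Category.assoc]
  exact congrArg CechPic.pullback
    (fibreAVIso_fiberUnivIso_inv_familyPullbackIso_inv_fiberι_comp_fst 𝓜 gS y P' G Ĝ h)

end UnivFamilyLDeltaClass

end Summit.HodgeConjecture.HodgeConjecture.Theorems

end
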